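/-
Copyright (c) 2026. All rights reserved.
Released under Apache 2.0 license as described in the file LICENSE.
-/
import Literature.NumberTheory.Automorphic.BrandtModuleDictionary
import Literature.NumberTheory.Automorphic.BrandtMatrixUnitCount
import Literature.NumberTheory.Automorphic.EichlerEmbeddingLocalGlobal
import Literature.NumberTheory.Automorphic.QuaternionOrderIntegral
import Literature.NumberTheory.Automorphic.QuaternionAlgebraAdelicReducedNormMulProofs
import Literature.NumberTheory.Automorphic.QuaternionAlgebraSplitting
import Literature.NumberTheory.Automorphic.QuaternionDefiniteNorm
import HarnessLib

/-!
# The maximal order `O₁₃ = ℤ⟨1, i, α, η⟩` (`α = (1 + i + j)/2`, `η = (−2 + i + k)/4`) of `(−2,−13 ∣ ℚ)` as a `ℤ`-lattice: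
# a maximal `ℤ`-order of the definite quaternion algebra of discriminant `13`, its norm form
# `a² + 2b² + 4c² + 2d² + ac − ad + 2bc + bd`, its `2` units

[tag: quaternion_algebra] [tag: maximal_order] [tag: class_number]

Topic `NumberTheory/Automorphic`; THEOREMS ONLY (no definition, no named fact, no instance; net Literature debt `0`).
Lane `lit-hodgefound`, seat p12, gen 46 — first file on THE definite quaternion order of discriminant `13`, the last case
`D = 13` of Voight's Theorem 25.4.1 («`# Cls O = 1` if and only if `D = 2, 3, 5, 7, 13`») and of Exercise 17.10 («maximal orders
`O` in quaternion algebras of discriminants `5, 7, 13` have `# Cls O = 1` … for discriminant `7, 13` the maximal orders are not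
Euclidean with respect to the norm»), after the Hurwitz order (`D = 2`, `HurwitzOrder*`), `O₃` (`MaximalOrderDiscThree*`), `O₅`
(`MaximalOrderDiscFive*`) and `O₇` (`MaximalOrderDiscSeven*`).

The algebra is Mathlib's `ℍ[ℚ,−2,−13] = (−2,−13 ∣ ℚ)` (`i² = −2`, `j² = −13`, `k = ij`, `k² = −26`), ramified exactly at `13` and `∞`
(`(−2,−13)₁₃ = (−2∕13) = −1`, `(−2,−13)₂ = 1`; the sequel `…Ramification`), whose standard order `ℤ⟨1, i, j, k⟩` has reduced
discriminant `4·2·13 = 104`; the maximal orders containing it have index `8`. Exactly as for `(−2,−5 ∣ ℚ)` (`13 ≡ 5 (mod 8)`) we take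

  `O₁₃ := ℤ + ℤi + ℤα + ℤη`,  `α = (1 + i + j)/2`  (`α² = α − 4`),  `η = (−2 + i + k)/4`  (`η² + η + 2 = 0`),

which contains `j = 2α − 1 − i` and `k = 4η + 2 − i`; in this file it is the INLINE lattice `Submodule.span ℤ {1, i, α, η}` (no
definition is introduced), in the vocabulary of the tree's Brandt–Eichler lattice theory, transposing `MaximalOrderDiscFiveLattice`:

* §1 `mem_lattice_iff` (**`x ∈ O₁₃ ⟺ x = (a + c/2 − d/2) + (b + c/2 + d/4)i + (c/2)j + (d/4)k`, `a, b, c, d ∈ ℤ`**),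
  `intCoords_mem_lattice` (`ℤ⟨1, i, j, k⟩ ⊆ O₁₃`), **`mul_mem_lattice`** (closed under multiplication — the product has the
  integral coordinates listed in the docstring), `star_mem_lattice`, `isFullLattice_lattice`, **`isZOrder_lattice`**, `isOrder_lattice`;
* §2 the algebra: `isQuaternionAlgebra`, **`reducedNorm_eq`** (`nrd x = x₀² + 2x₁² + 13x₂² + 26x₃²`), **`reducedNorm_mk`**
  (in the coordinates of `O₁₃`: `nrd(a + bi + cα + dη) = a² + 2b² + 4c² + 2d² + ac − ad + 2bc + bd`), `reducedTrace_eq_two_mul_re`,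
  `forall_isUnit`, `mem_bot_iff`, `not_mem_bot_of_re_eq_zero`;
* §3 **`isMaximalZOrder_lattice`** — `O₁₃` IS A MAXIMAL `ℤ`-ORDER: an order `O' ⊇ O₁₃` has integral reduced traces and norms;
  applied to `x, xi, xα, xη ∈ O'` this gives `2x₀, 4x₁, x₀ − 2x₁ − 13x₂, −x₀ − x₁ − 13x₃ ∈ ℤ` and `nrd x ∈ ℤ`, whence `x ∈ O₁₃`
  (`mem_lattice_of_int_traces_norm`: `104·nrd = 26T² + 13X² + 2Y² + Z²` with `Y = 26x₂`, `Z = 52x₃`, and `2Y² + Z² ≡ 0 (mod 13)`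
  forces `13 ∣ Y, Z` since `−2` is a non-residue mod `13`); `isMaximalOrder_lattice`, **`isEichlerOrder_one_lattice`**,
  `brandt_isEichlerOrder_one_lattice`;
* §4 units: `leftOrder_lattice`, `exists_inv_mem_iff_reducedNorm_eq_one`, `units_smul_lattice_eq_iff`,
  **`natCard_reducedNorm_eq_natCard_form`**, `natCard_form_eq_one` (`= 2`), **`card_units_lattice`** (`#O₁₃^× = 2`: `±1` —
  the only definite maximal order over `ℚ` of class number one with trivial reduced unit group), **`unitIndex_lattice`**
  (`w(O₁₃) = 1` — Eichler's mass at `D = 13` is `(13 − 1)/12 = 1 = 1/w`), `card_stabilizer_lattice`.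

## Sources

* J. Voight, *Quaternion Algebras*, GTM 288 (2021): Exercise 17.10 ((a) «Show that maximal orders `O` in quaternion algebras of
  discriminants `5, 7, 13` have `# Cls O = 1`»; (b) the quaternary form `t² + ty + tz + 2x² + xy + 2xz + 2y² + yz + 4z²` is
  multiplicative and universal; (c) «for discriminant `7, 13` the maximal orders are not Euclidean with respect to the norm»),
  Thm. 25.4.1, Thm. 25.1.1 (mass `φ(13)/12 = 1`), Thm. 11.5.14 (unit groups of definite orders over `ℚ`), Def. 10.2.1, 10.4.1,
  15.5 (discriminants), 23.4.1. [cite: Voight2021, Exercise 17.10; Thm. 25.4.1; Thm. 25.1.1; Thm. 11.5.14]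
* M.-F. Vignéras, *Arithmétique des algèbres de quaternions*, LNM 800 (1980), Ch. I §4 Déf. (ordre, ordre maximal, ordre
  d'Eichler), Lemme 4.12; Ch. V §3 (the orders of class number one over `ℚ`). [cite: VignerasLNM800, Ch. I §4 Déf. and Lemme 4.12]
* A. Cardoso, A. Machiavelo, arXiv:2506.22651 (2025), §5.2 Thm. 9 (the maximal order of discriminant `13` — there inside
  `(−7,−13 ∣ ℚ)` — is a PID, by a Dedekind–Hasse-type criterion). [cite: CardosoMachiavelo2025, §5.2 Thm. 9]

## Scope (honest)

Theorems only — no definition, no named fact, no instance. The basis `1, i, α, η` and the resulting norm form are this file's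
(explicit) choice of coordinates for the maximal order of discriminant `13` (all maximal orders of `(−2,−13 ∣ ℚ)` are conjugate
once `# Cls = 1` is known); the ramification `Ram = {13, ∞}`, the class number (by Minkowski's theorem and a certificate — the
order is NOT norm-Euclidean) and the Brandt matrices are left to sequel files.
-/

open Quaternion
open scoped Pointwise
open Literature.NumberTheory.Automorphic.Brandt

namespace Literature.NumberTheory.Automorphic.MaxOrderDiscThirteen

/-! ## §1 The lattice `O₁₃ = ℤ⟨1, i, α, η⟩` -/

section Lattice

/-- The generic element of the span: `a·1 + b·i + c·α + d·η` in coordinates. [folklore] -/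
private theorem sum_smul_gens (c : Fin 4 → ℤ) :
    ∑ k, c k • (![(⟨1, 0, 0, 0⟩ : ℍ[ℚ,-2,-13]), ⟨0, 1, 0, 0⟩, ⟨1/2, 1/2, 1/2, 0⟩, ⟨-1/2, 1/4, 0, 1/4⟩]) k =
      (⟨(c 0 : ℚ) + (c 2 : ℚ) / 2 - (c 3 : ℚ) / 2, (c 1 : ℚ) + (c 2 : ℚ) / 2 + (c 3 : ℚ) / 4, (c 2 : ℚ) / 2, (c 3 : ℚ) / 4⟩ : ℍ[ℚ,-2,-13]) := by
  simp only [Fin.sum_univ_four, Matrix.cons_val_zero, Matrix.cons_val_one, Matrix.cons_val,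
    ← Int.cast_smul_eq_zsmul ℚ, QuaternionAlgebra.smul_mk, smul_eq_mul, QuaternionAlgebra.mk_add_mk]
  rw [QuaternionAlgebra.mk.injEq]
  refine ⟨by ring, by ring, by ring, by ring⟩

/-- **`x ∈ O₁₃ ⟺ x = (a + c/2 − d/2) + (b + c/2 + d/4)i + (c/2)j + (d/4)k` with `a, b, c, d ∈ ℤ`** (`x = a + bi + cα + dη`).
[cite: Voight2021, Exercise 17.10] -/
theorem mem_lattice_iff (x : ℍ[ℚ,-2,-13]) :
    x ∈ (Submodule.span ℤ (Set.range ![(⟨1, 0, 0, 0⟩ : ℍ[ℚ,-2,-13]), ⟨0, 1, 0, 0⟩, ⟨1/2, 1/2, 1/2, 0⟩, ⟨-1/2, 1/4, 0, 1/4⟩])) ↔ ∃ a b c d : ℤ, x = ⟨(a : ℚ) + (c : ℚ) / 2 - (d : ℚ) / 2, (b : ℚ) + (c : ℚ) / 2 + (d : ℚ) / 4, (c : ℚ) / 2, (d : ℚ) / 4⟩ := by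
  rw [Submodule.mem_span_range_iff_exists_fun]
  constructor
  · rintro ⟨c, rfl⟩
    exact ⟨c 0, c 1, c 2, c 3, sum_smul_gens c⟩
  · rintro ⟨a, b, c, d, rfl⟩
    refine ⟨![a, b, c, d], ?_⟩
    rw [sum_smul_gens]
    rfl

/-- `a + bi + cα + dη ∈ O₁₃` for integers `a, b, c, d`. [cite: Voight2021, Exercise 17.10] -/
theorem mk_mem_lattice (a b c d : ℤ) :
    (⟨(a : ℚ) + (c : ℚ) / 2 - (d : ℚ) / 2, (b : ℚ) + (c : ℚ) / 2 + (d : ℚ) / 4, (c : ℚ) / 2, (d : ℚ) / 4⟩ : ℍ[ℚ,-2,-13]) ∈ (Submodule.span ℤ (Set.range ![(⟨1, 0, 0, 0⟩ : ℍ[ℚ,-2,-13]), ⟨0, 1, 0, 0⟩, ⟨1/2, 1/2, 1/2, 0⟩, ⟨-1/2, 1/4, 0, 1/4⟩])) :=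
  (mem_lattice_iff _).2 ⟨a, b, c, d, rfl⟩

/-- Quaternions with integral coordinates (`ℤ⟨1, i, j, k⟩`) lie in `O₁₃`: `t + xi + yj + zk = (t − y + 2z) + (x − y − z)i + (2y)α + (4z)η`.
[cite: Voight2021, Exercise 17.10] -/
theorem intCoords_mem_lattice (a b c d : ℤ) : (⟨(a : ℚ), (b : ℚ), (c : ℚ), (d : ℚ)⟩ : ℍ[ℚ,-2,-13]) ∈ (Submodule.span ℤ (Set.range ![(⟨1, 0, 0, 0⟩ : ℍ[ℚ,-2,-13]), ⟨0, 1, 0, 0⟩, ⟨1/2, 1/2, 1/2, 0⟩, ⟨-1/2, 1/4, 0, 1/4⟩])) := by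
  refine (mem_lattice_iff _).2 ⟨a - c + 2 * d, b - c - d, 2 * c, 4 * d, ?_⟩
  push_cast
  rw [QuaternionAlgebra.mk.injEq]
  refine ⟨by ring, by ring, by ring, by ring⟩

/-- `1 ∈ O₁₃`. [cite: VignerasLNM800, Ch. I §4 Déf. (ordre)] -/
theorem one_mem_lattice : (1 : ℍ[ℚ,-2,-13]) ∈ (Submodule.span ℤ (Set.range ![(⟨1, 0, 0, 0⟩ : ℍ[ℚ,-2,-13]), ⟨0, 1, 0, 0⟩, ⟨1/2, 1/2, 1/2, 0⟩, ⟨-1/2, 1/4, 0, 1/4⟩])) :=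
  Submodule.subset_span ⟨0, rfl⟩

/-- `i ∈ O₁₃`. [cite: Voight2021, Exercise 17.10] -/
theorem basisI_mem_lattice : (⟨0, 1, 0, 0⟩ : ℍ[ℚ,-2,-13]) ∈ (Submodule.span ℤ (Set.range ![(⟨1, 0, 0, 0⟩ : ℍ[ℚ,-2,-13]), ⟨0, 1, 0, 0⟩, ⟨1/2, 1/2, 1/2, 0⟩, ⟨-1/2, 1/4, 0, 1/4⟩])) :=
  Submodule.subset_span ⟨1, rfl⟩

/-- `α = (1 + i + j)/2 ∈ O₁₃`. [cite: Voight2021, Exercise 17.10] -/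
theorem alpha_mem_lattice : (⟨1/2, 1/2, 1/2, 0⟩ : ℍ[ℚ,-2,-13]) ∈ (Submodule.span ℤ (Set.range ![(⟨1, 0, 0, 0⟩ : ℍ[ℚ,-2,-13]), ⟨0, 1, 0, 0⟩, ⟨1/2, 1/2, 1/2, 0⟩, ⟨-1/2, 1/4, 0, 1/4⟩])) :=
  Submodule.subset_span ⟨2, rfl⟩

/-- `η = (−2 + i + k)/4 ∈ O₁₃`. [cite: Voight2021, Exercise 17.10] -/
theorem eta_mem_lattice : (⟨-1/2, 1/4, 0, 1/4⟩ : ℍ[ℚ,-2,-13]) ∈ (Submodule.span ℤ (Set.range ![(⟨1, 0, 0, 0⟩ : ℍ[ℚ,-2,-13]), ⟨0, 1, 0, 0⟩, ⟨1/2, 1/2, 1/2, 0⟩, ⟨-1/2, 1/4, 0, 1/4⟩])) :=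
  Submodule.subset_span ⟨3, rfl⟩

/-- `j ∈ O₁₃`. [cite: Voight2021, Exercise 17.10] -/
theorem basisJ_mem_lattice : (⟨0, 0, 1, 0⟩ : ℍ[ℚ,-2,-13]) ∈ (Submodule.span ℤ (Set.range ![(⟨1, 0, 0, 0⟩ : ℍ[ℚ,-2,-13]), ⟨0, 1, 0, 0⟩, ⟨1/2, 1/2, 1/2, 0⟩, ⟨-1/2, 1/4, 0, 1/4⟩])) := by
  exact_mod_cast intCoords_mem_lattice 0 0 1 0

/-- `k = ij ∈ O₁₃`. [cite: Voight2021, Exercise 17.10] -/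
theorem basisK_mem_lattice : (⟨0, 0, 0, 1⟩ : ℍ[ℚ,-2,-13]) ∈ (Submodule.span ℤ (Set.range ![(⟨1, 0, 0, 0⟩ : ℍ[ℚ,-2,-13]), ⟨0, 1, 0, 0⟩, ⟨1/2, 1/2, 1/2, 0⟩, ⟨-1/2, 1/4, 0, 1/4⟩])) := by
  exact_mod_cast intCoords_mem_lattice 0 0 0 1

/-- **`O₁₃` is closed under multiplication**: the product of `a + bi + cα + dη` and `a' + b'i + c'α + d'η` is
`A + Bi + Cα + Dη` with `A = aa' − 2bb' − 2cb' − db' − 4cc' − 2dd'`, `B = ba' + ab' + cb' − db' − 2dc' + 2cd'`,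
`C = ca' + db' + ac' + cc' − bd' − cd'`, `D = da' − 2cb' + 2bc' + dc' + ad' − dd'` (all integral).
[cite: Voight2021, Exercise 17.10 and Def. 10.2.1] -/
theorem mul_mem_lattice {x y : ℍ[ℚ,-2,-13]} (hx : x ∈ (Submodule.span ℤ (Set.range ![(⟨1, 0, 0, 0⟩ : ℍ[ℚ,-2,-13]), ⟨0, 1, 0, 0⟩, ⟨1/2, 1/2, 1/2, 0⟩, ⟨-1/2, 1/4, 0, 1/4⟩]))) (hy : y ∈ (Submodule.span ℤ (Set.range ![(⟨1, 0, 0, 0⟩ : ℍ[ℚ,-2,-13]), ⟨0, 1, 0, 0⟩, ⟨1/2, 1/2, 1/2, 0⟩, ⟨-1/2, 1/4, 0, 1/4⟩]))) : x * y ∈ (Submodule.span ℤ (Set.range ![(⟨1, 0, 0, 0⟩ : ℍ[ℚ,-2,-13]), ⟨0, 1, 0, 0⟩, ⟨1/2, 1/2, 1/2, 0⟩, ⟨-1/2, 1/4, 0, 1/4⟩])) := by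
  obtain ⟨a, b, c, d, rfl⟩ := (mem_lattice_iff x).1 hx
  obtain ⟨a', b', c', d', rfl⟩ := (mem_lattice_iff y).1 hy
  refine (mem_lattice_iff _).2 ⟨a * a' - 2 * b * b' - 2 * c * b' - d * b' - 4 * c * c' - 2 * d * d',
    b * a' + a * b' + c * b' - d * b' - 2 * d * c' + 2 * c * d', c * a' + d * b' + a * c' + c * c' - b * d' - c * d',
    d * a' - 2 * c * b' + 2 * b * c' + d * c' + a * d' - d * d', ?_⟩
  rw [QuaternionAlgebra.mk_mul_mk]
  push_cast
  rw [QuaternionAlgebra.mk.injEq]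
  refine ⟨by ring, by ring, by ring, by ring⟩

/-- `O₁₃` is stable under the conjugation `x ↦ x̄` (`a + bi + cα + dη ↦ (a + c − d) − bi − cα − dη`).
[cite: VignerasLNM800, Ch. I §4 Déf.] -/
theorem star_mem_lattice {x : ℍ[ℚ,-2,-13]} (hx : x ∈ (Submodule.span ℤ (Set.range ![(⟨1, 0, 0, 0⟩ : ℍ[ℚ,-2,-13]), ⟨0, 1, 0, 0⟩, ⟨1/2, 1/2, 1/2, 0⟩, ⟨-1/2, 1/4, 0, 1/4⟩]))) : star x ∈ (Submodule.span ℤ (Set.range ![(⟨1, 0, 0, 0⟩ : ℍ[ℚ,-2,-13]), ⟨0, 1, 0, 0⟩, ⟨1/2, 1/2, 1/2, 0⟩, ⟨-1/2, 1/4, 0, 1/4⟩])) := by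
  obtain ⟨a, b, c, d, rfl⟩ := (mem_lattice_iff x).1 hx
  refine (mem_lattice_iff _).2 ⟨a + c - d, -b, -c, -d, ?_⟩
  rw [QuaternionAlgebra.star_mk]
  push_cast
  rw [QuaternionAlgebra.mk.injEq]
  refine ⟨by ring, by ring, by ring, by ring⟩

/-- `O₁₃` is finitely generated. [cite: VignerasLNM800, Ch. I §4 Déf. (réseau)] -/
theorem fg_lattice : ((Submodule.span ℤ (Set.range ![(⟨1, 0, 0, 0⟩ : ℍ[ℚ,-2,-13]), ⟨0, 1, 0, 0⟩, ⟨1/2, 1/2, 1/2, 0⟩, ⟨-1/2, 1/4, 0, 1/4⟩]))).FG :=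
  Submodule.fg_span (Set.finite_range _)

/-- **Bounded denominators**: every element of `(−2,−13)_ℚ` has a positive integer multiple with integral coordinates.
[cite: VignerasLNM800, Ch. I §4 Déf. (réseau complet)] -/
theorem exists_nsmul_eq_intCoords (x : ℍ[ℚ,-2,-13]) :
    ∃ N : ℕ, 0 < N ∧ ∃ a b c d : ℤ, (N : ℤ) • x = (⟨(a : ℚ), (b : ℚ), (c : ℚ), (d : ℚ)⟩ : ℍ[ℚ,-2,-13]) := by
  have key : ∀ (q : ℚ) (k : ℕ), ∃ z : ℤ, ((q.den * k : ℕ) : ℚ) * q = z := fun q k =>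
    ⟨q.num * k, by push_cast; rw [mul_comm (q.den : ℚ) k, mul_assoc, Rat.den_mul_eq_num]; ring⟩
  refine ⟨x.re.den * (x.imI.den * x.imJ.den * x.imK.den), by positivity, ?_⟩
  obtain ⟨a, ha⟩ := key x.re (x.imI.den * x.imJ.den * x.imK.den)
  obtain ⟨b, hb⟩ := key x.imI (x.re.den * x.imJ.den * x.imK.den)
  obtain ⟨c, hc⟩ := key x.imJ (x.re.den * x.imI.den * x.imK.den)
  obtain ⟨d, hd⟩ := key x.imK (x.re.den * x.imI.den * x.imJ.den)
  refine ⟨a, b, c, d, ?_⟩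
  rw [← Int.cast_smul_eq_zsmul ℚ, Int.cast_natCast]
  have eb : ((x.re.den * (x.imI.den * x.imJ.den * x.imK.den) : ℕ) : ℚ) =
      ((x.imI.den * (x.re.den * x.imJ.den * x.imK.den) : ℕ) : ℚ) := by push_cast; ring
  have ec : ((x.re.den * (x.imI.den * x.imJ.den * x.imK.den) : ℕ) : ℚ) =
      ((x.imJ.den * (x.re.den * x.imI.den * x.imK.den) : ℕ) : ℚ) := by push_cast; ring
  have ed : ((x.re.den * (x.imI.den * x.imJ.den * x.imK.den) : ℕ) : ℚ) =
      ((x.imK.den * (x.re.den * x.imI.den * x.imJ.den) : ℕ) : ℚ) := by push_cast; ring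
  ext
  · rw [QuaternionAlgebra.re_smul, smul_eq_mul, ha]
  · rw [QuaternionAlgebra.imI_smul, smul_eq_mul, eb, hb]
  · rw [QuaternionAlgebra.imJ_smul, smul_eq_mul, ec, hc]
  · rw [QuaternionAlgebra.imK_smul, smul_eq_mul, ed, hd]

/-- **`O₁₃` is a full `ℤ`-lattice of `B = (−2,−13)_ℚ`.** [cite: VignerasLNM800, Ch. I §4 Déf. (réseau complet, idéal)] -/
theorem isFullLattice_lattice : IsFullLattice ℍ[ℚ,-2,-13] (Submodule.span ℤ (Set.range ![(⟨1, 0, 0, 0⟩ : ℍ[ℚ,-2,-13]), ⟨0, 1, 0, 0⟩, ⟨1/2, 1/2, 1/2, 0⟩, ⟨-1/2, 1/4, 0, 1/4⟩])) := by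
  refine ⟨fg_lattice, fun x => ?_⟩
  obtain ⟨N, hN, a, b, c, d, h⟩ := exists_nsmul_eq_intCoords x
  exact ⟨N, by exact_mod_cast hN.ne', by rw [h]; exact intCoords_mem_lattice a b c d⟩

/-- **`O₁₃` is a `ℤ`-order.** [cite: Voight2021, Exercise 17.10 and Def. 10.2.1] [cite: VignerasLNM800, Ch. I §4 Déf. (ordre)] -/
theorem isZOrder_lattice : IsZOrder (Submodule.span ℤ (Set.range ![(⟨1, 0, 0, 0⟩ : ℍ[ℚ,-2,-13]), ⟨0, 1, 0, 0⟩, ⟨1/2, 1/2, 1/2, 0⟩, ⟨-1/2, 1/4, 0, 1/4⟩])) :=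
  ⟨one_mem_lattice, fun _ hx _ hy => mul_mem_lattice hx hy, isFullLattice_lattice⟩

/-- `O₁₃` is an order in the `Brandt.IsOrder` sense. [cite: Voight2021, Def. 10.2.1] -/
theorem isOrder_lattice : Brandt.IsOrder ℍ[ℚ,-2,-13] (Submodule.span ℤ (Set.range ![(⟨1, 0, 0, 0⟩ : ℍ[ℚ,-2,-13]), ⟨0, 1, 0, 0⟩, ⟨1/2, 1/2, 1/2, 0⟩, ⟨-1/2, 1/4, 0, 1/4⟩])) :=
  isZOrder_iff_isOrder.1 isZOrder_lattice

end Lattice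

/-! ## §2 The algebra `(−2,−13)_ℚ`: quaternion algebra, reduced norm in the coordinates of `O₁₃`, division, centre -/

section Algebra

/-- **`(−2,−13)_ℚ` is a quaternion algebra over `ℚ`.** [cite: VignerasLNM800, Ch. I §1] -/
theorem isQuaternionAlgebra : IsQuaternionAlgebra ℚ ℍ[ℚ,-2,-13] :=
  QuaternionAlgebra.isQuaternionAlgebra_holds (K := ℚ) (a := -2) (b := -13) (by norm_num) (by norm_num)

/-- **The reduced norm of `(−2,−13)_ℚ` is `nrd x = x₀² + 2x₁² + 13x₂² + 26x₃²`.** [cite: VignerasLNM800, Ch. I §1 (norme réduite)] -/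
theorem reducedNorm_eq (x : ℍ[ℚ,-2,-13]) : reducedNorm ℚ ℍ[ℚ,-2,-13] x = x.re ^ 2 + 2 * x.imI ^ 2 + 13 * x.imJ ^ 2 + 26 * x.imK ^ 2 := by
  rw [reducedNorm_quaternionAlgebra (K := ℚ) (a := -2) (b := -13) x]
  ring

/-- **In the coordinates of `O₁₃` the reduced norm is the integral quaternary form `a² + 2b² + 4c² + 2d² + ac − ad + 2bc + bd`**
(of discriminant `169`). [cite: Voight2021, Exercise 17.10 (b)] -/
theorem reducedNorm_mk (a b c d : ℤ) :
    reducedNorm ℚ ℍ[ℚ,-2,-13] ⟨(a : ℚ) + (c : ℚ) / 2 - (d : ℚ) / 2, (b : ℚ) + (c : ℚ) / 2 + (d : ℚ) / 4, (c : ℚ) / 2, (d : ℚ) / 4⟩ =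
      ((a ^ 2 + 2 * b ^ 2 + 4 * c ^ 2 + 2 * d ^ 2 + a * c - a * d + 2 * b * c + b * d : ℤ) : ℚ) := by
  rw [reducedNorm_eq]
  push_cast
  ring

/-- **The reduced trace is `2x₀`.** [cite: VignerasLNM800, Ch. I §1 (trace réduite)] -/
theorem reducedTrace_eq_two_mul_re (x : ℍ[ℚ,-2,-13]) : reducedTrace ℚ ℍ[ℚ,-2,-13] x = 2 * x.re :=
  reducedTrace_quaternionAlgebra (K := ℚ) (a := -2) (b := -13) x

/-- `x x̄ = nrd x` in coordinates: `(x x̄)₀ = x₀² + 2x₁² + 13x₂² + 26x₃²`. [cite: VignerasLNM800, Ch. I §1] -/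
theorem re_mul_star (x : ℍ[ℚ,-2,-13]) : (x * star x).re = x.re ^ 2 + 2 * x.imI ^ 2 + 13 * x.imJ ^ 2 + 26 * x.imK ^ 2 := by
  simp [QuaternionAlgebra.re_mul]
  ring

/-- **`(−2,−13)_ℚ` is a division algebra**: the norm form `x₀² + 2x₁² + 13x₂² + 26x₃²` is anisotropic.
[cite: VignerasLNM800, Ch. I §1] -/
theorem forall_isUnit : ∀ x : ℍ[ℚ,-2,-13], x ≠ 0 → IsUnit x := by
  haveI := isQuaternionAlgebra
  intro x hx
  exact (isUnit_iff_reducedNorm_ne_zero_holds ℚ ℍ[ℚ,-2,-13] x).mpr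
    (QuaternionAlgebra.reducedNorm_pos (a := -2) (b := -13) (by norm_num) (by norm_num) hx).ne'

/-- The centre: `x ∈ ⊥ = ℚ·1 ⟺ x = (x₀, 0, 0, 0)`. [cite: VignerasLNM800, Ch. I §1 (algèbre centrale)] -/
theorem mem_bot_iff (x : ℍ[ℚ,-2,-13]) : x ∈ (⊥ : Subalgebra ℚ ℍ[ℚ,-2,-13]) ↔ x.imI = 0 ∧ x.imJ = 0 ∧ x.imK = 0 := by
  rw [Algebra.mem_bot]
  constructor
  · rintro ⟨c, rfl⟩
    rw [Algebra.algebraMap_eq_smul_one]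
    simp
  · rintro ⟨h1, h2, h3⟩
    refine ⟨x.re, ?_⟩
    rw [Algebra.algebraMap_eq_smul_one]
    ext <;> simp [h1, h2, h3]

/-- **A non-zero pure quaternion is not central.** [cite: VignerasLNM800, Ch. I §1 (quaternions purs)] -/
theorem not_mem_bot_of_re_eq_zero {x : ℍ[ℚ,-2,-13]} (hre : x.re = 0) (hx : x ≠ 0) : x ∉ (⊥ : Subalgebra ℚ ℍ[ℚ,-2,-13]) := by
  intro h
  obtain ⟨h1, h2, h3⟩ := (mem_bot_iff x).1 h
  apply hx
  ext <;> simp [hre, h1, h2, h3]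

/-- Elements of `O₁₃` have integral reduced norm. [cite: Voight2021, Exercise 17.10 (b)] -/
theorem exists_reducedNorm_eq_intCast_of_mem {x : ℍ[ℚ,-2,-13]} (hx : x ∈ (Submodule.span ℤ (Set.range ![(⟨1, 0, 0, 0⟩ : ℍ[ℚ,-2,-13]), ⟨0, 1, 0, 0⟩, ⟨1/2, 1/2, 1/2, 0⟩, ⟨-1/2, 1/4, 0, 1/4⟩]))) : ∃ n : ℤ, reducedNorm ℚ ℍ[ℚ,-2,-13] x = n := by
  obtain ⟨a, b, c, d, rfl⟩ := (mem_lattice_iff x).1 hx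
  exact ⟨_, reducedNorm_mk a b c d⟩

/-- The reduced norm of an element of `O₁₃` is a natural number. [cite: Voight2021, Exercise 17.10 (b)] -/
theorem exists_reducedNorm_eq_natCast_of_mem {x : ℍ[ℚ,-2,-13]} (hx : x ∈ (Submodule.span ℤ (Set.range ![(⟨1, 0, 0, 0⟩ : ℍ[ℚ,-2,-13]), ⟨0, 1, 0, 0⟩, ⟨1/2, 1/2, 1/2, 0⟩, ⟨-1/2, 1/4, 0, 1/4⟩]))) : ∃ n : ℕ, reducedNorm ℚ ℍ[ℚ,-2,-13] x = n := by
  obtain ⟨n, hn⟩ := exists_reducedNorm_eq_intCast_of_mem hx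
  have h0 : 0 ≤ reducedNorm ℚ ℍ[ℚ,-2,-13] x :=
    QuaternionAlgebra.reducedNorm_nonneg (a := -2) (b := -13) (by norm_num) (by norm_num) x
  rw [hn] at h0
  refine ⟨n.toNat, ?_⟩
  rw [hn]
  exact_mod_cast (Int.toNat_of_nonneg (by exact_mod_cast h0)).symm

end Algebra

/-! ## §3 `O₁₃` is a maximal `ℤ`-order (an Eichler order of level `1`) -/

section Maximal

/-- `2u² + v² = 0` in `𝔽₁₃` forces `u = v = 0` (`−2` is a non-residue mod `13`). [folklore] -/
private theorem two_mul_sq_add_sq_zmod_thirteen : ∀ u v : ZMod 13, 2 * u ^ 2 + v ^ 2 = 0 → u = 0 ∧ v = 0 := by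
  decide

/-- `2Y² + Z² ≡ 0 (mod 13)` forces `13 ∣ Y` and `13 ∣ Z`. [folklore] -/
private theorem thirteen_dvd_of_two_mul_sq_add_sq {Y Z : ℤ} (h : (13 : ℤ) ∣ 2 * Y ^ 2 + Z ^ 2) : (13 : ℤ) ∣ Y ∧ (13 : ℤ) ∣ Z := by
  have hY := ZMod.intCast_zmod_eq_zero_iff_dvd Y 13
  have hZ := ZMod.intCast_zmod_eq_zero_iff_dvd Z 13
  push_cast at hY hZ
  have h5 := (ZMod.intCast_zmod_eq_zero_iff_dvd (2 * Y ^ 2 + Z ^ 2) 13).2 (by exact_mod_cast h)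
  push_cast at h5
  rw [← hY, ← hZ]
  exact two_mul_sq_add_sq_zmod_thirteen _ _ h5

/-- **The integrality criterion**: a quaternion of `(−2,−13)_ℚ` with `2x₀, 4x₁, x₀ − 2x₁ − 13x₂, −x₀ − x₁ − 13x₃ ∈ ℤ` (the reduced
traces of `x, −xi/·, xα, xη`) and integral reduced norm lies in `O₁₃`: with `T = 2x₀`, `X = 4x₁`, `Y = 26x₂ = T − X − 2U`,
`Z = 52x₃ = −2T − X − 4W` one has `104·nrd = 26T² + 13X² + 2Y² + Z²`, so `2Y² + Z² ≡ 0 (mod 13)` and `13 ∣ Y, Z`, i.e.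
`2x₂, 4x₃ ∈ ℤ`; the remaining congruences `4 ∣ X − 2(2x₂) − 4x₃`, `2 ∣ T − 2x₂ + 4x₃` are linear. [cite: Voight2021, Exercise 17.10 and §15.5] -/
theorem mem_lattice_of_int_traces_norm {x : ℍ[ℚ,-2,-13]} {T X U W n : ℤ} (h₀ : 2 * x.re = T) (h₁ : 4 * x.imI = X)
    (h₂ : x.re - 2 * x.imI - 13 * x.imJ = U) (h₃ : -x.re - x.imI - 13 * x.imK = W)
    (hn : x.re ^ 2 + 2 * x.imI ^ 2 + 13 * x.imJ ^ 2 + 26 * x.imK ^ 2 = n) : x ∈ (Submodule.span ℤ (Set.range ![(⟨1, 0, 0, 0⟩ : ℍ[ℚ,-2,-13]), ⟨0, 1, 0, 0⟩, ⟨1/2, 1/2, 1/2, 0⟩, ⟨-1/2, 1/4, 0, 1/4⟩])) := by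
  have hY : 26 * x.imJ = ((T - X - 2 * U : ℤ) : ℚ) := by push_cast; linarith
  have hZ : 52 * x.imK = ((-2 * T - X - 4 * W : ℤ) : ℚ) := by push_cast; linarith
  have h40 : 26 * T ^ 2 + 13 * X ^ 2 + 2 * (T - X - 2 * U) ^ 2 + (-2 * T - X - 4 * W) ^ 2 = 104 * n := by
    have h : 26 * (T : ℚ) ^ 2 + 13 * (X : ℚ) ^ 2 + 2 * ((T - X - 2 * U : ℤ) : ℚ) ^ 2 + ((-2 * T - X - 4 * W : ℤ) : ℚ) ^ 2 =
        104 * n := by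
      rw [← hY, ← hZ, ← h₀, ← h₁, ← hn]
      ring
    exact_mod_cast h
  have h5 : (13 : ℤ) ∣ 2 * (T - X - 2 * U) ^ 2 + (-2 * T - X - 4 * W) ^ 2 :=
    ⟨8 * n - 2 * T ^ 2 - X ^ 2, by linear_combination h40⟩
  obtain ⟨⟨m, hm⟩, ⟨m', hm'⟩⟩ := thirteen_dvd_of_two_mul_sq_add_sq h5
  have hJ : 2 * x.imJ = m := by
    have : (26 : ℚ) * x.imJ = 13 * m := by rw [hY, hm]; push_cast; ring
    linarith
  have hK : 4 * x.imK = m' := by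
    have : (52 : ℚ) * x.imK = 13 * m' := by rw [hZ, hm']; push_cast; ring
    linarith
  obtain ⟨a, ha⟩ : (2 : ℤ) ∣ T - m + m' := by omega
  obtain ⟨b, hb⟩ : (4 : ℤ) ∣ X - 2 * m - m' := by omega
  refine (mem_lattice_iff x).2 ⟨a, b, m, m', ?_⟩
  have ha' : (T : ℚ) - m + m' = 2 * a := by exact_mod_cast ha
  have hb' : (X : ℚ) - 2 * m - m' = 4 * b := by exact_mod_cast hb
  ext <;> push_cast <;> linarith

/-- The real parts of `x·i`, `x·α`, `x·η`. [folklore] -/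
private theorem re_mul_gens (x : ℍ[ℚ,-2,-13]) :
    (x * ⟨0, 1, 0, 0⟩).re = -2 * x.imI ∧ (x * ⟨1/2, 1/2, 1/2, 0⟩).re = x.re / 2 - x.imI - 13 * x.imJ / 2 ∧
      (x * ⟨-1/2, 1/4, 0, 1/4⟩).re = -(x.re / 2) - x.imI / 2 - 13 * x.imK / 2 := by
  refine ⟨?_, ?_, ?_⟩ <;> simp [QuaternionAlgebra.re_mul] <;> ring

/-- **`O₁₃` IS A MAXIMAL `ℤ`-ORDER of `(−2,−13)_ℚ`**: a `ℤ`-order `O' ⊇ O₁₃` has integral reduced traces and norms; for `x ∈ O'`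
also `xi, xα, xη ∈ O'`, and the integrality criterion gives `x ∈ O₁₃`. [cite: Voight2021, Exercise 17.10 and Def. 10.4.1] [cite: VignerasLNM800, Ch. I §4 Déf. (ordre maximal)] -/
theorem isMaximalZOrder_lattice : IsMaximalZOrder (Submodule.span ℤ (Set.range ![(⟨1, 0, 0, 0⟩ : ℍ[ℚ,-2,-13]), ⟨0, 1, 0, 0⟩, ⟨1/2, 1/2, 1/2, 0⟩, ⟨-1/2, 1/4, 0, 1/4⟩])) := by
  haveI := isQuaternionAlgebra
  refine ⟨isZOrder_lattice, fun O' hO' hle => le_antisymm (fun x hx => ?_) hle⟩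
  have hO'B : Brandt.IsOrder ℍ[ℚ,-2,-13] O' := isZOrder_iff_isOrder.1 hO'
  obtain ⟨t₀, n, ht₀, hn⟩ := hO'B.exists_int_reducedTrace_reducedNorm hx
  obtain ⟨t₁, -, ht₁, -⟩ := hO'B.exists_int_reducedTrace_reducedNorm (hO'.mul_mem _ hx _ (hle basisI_mem_lattice))
  obtain ⟨t₂, -, ht₂, -⟩ := hO'B.exists_int_reducedTrace_reducedNorm (hO'.mul_mem _ hx _ (hle alpha_mem_lattice))
  obtain ⟨t₃, -, ht₃, -⟩ := hO'B.exists_int_reducedTrace_reducedNorm (hO'.mul_mem _ hx _ (hle eta_mem_lattice))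
  rw [reducedTrace_eq_two_mul_re] at ht₀ ht₁ ht₂ ht₃
  rw [reducedNorm_eq] at hn
  obtain ⟨e₁, e₂, e₃⟩ := re_mul_gens x
  rw [e₁] at ht₁
  rw [e₂] at ht₂
  rw [e₃] at ht₃
  refine mem_lattice_of_int_traces_norm (T := t₀) (X := -t₁) (U := t₂) (W := t₃) (n := n) ht₀ ?_ ?_ ?_ hn
  · push_cast; linarith
  · linarith
  · linarith

/-- `O₁₃` is a maximal order in the `Brandt.IsMaximalOrder` sense. [cite: Voight2021, Def. 10.4.1 and Exercise 17.10] -/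
theorem isMaximalOrder_lattice : Brandt.IsMaximalOrder ℍ[ℚ,-2,-13] (Submodule.span ℤ (Set.range ![(⟨1, 0, 0, 0⟩ : ℍ[ℚ,-2,-13]), ⟨0, 1, 0, 0⟩, ⟨1/2, 1/2, 1/2, 0⟩, ⟨-1/2, 1/4, 0, 1/4⟩])) :=
  isMaximalZOrder_iff_isMaximalOrder.1 isMaximalZOrder_lattice

/-- **`O₁₃` is an Eichler order of level `1`.** [cite: VignerasLNM800, Ch. I §4 Déf. (ordre d'Eichler)] [cite: Voight2021, Def. 23.4.1] -/
theorem isEichlerOrder_one_lattice : IsEichlerOrder (Submodule.span ℤ (Set.range ![(⟨1, 0, 0, 0⟩ : ℍ[ℚ,-2,-13]), ⟨0, 1, 0, 0⟩, ⟨1/2, 1/2, 1/2, 0⟩, ⟨-1/2, 1/4, 0, 1/4⟩])) 1 :=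
  isMaximalZOrder_lattice.isEichlerOrder_one

/-- `O₁₃` is an Eichler order of level `1` in the `Brandt` sense. [cite: VignerasLNM800, Ch. I §4 Déf. (ordre d'Eichler)] -/
theorem brandt_isEichlerOrder_one_lattice : Brandt.IsEichlerOrder ℍ[ℚ,-2,-13] (Submodule.span ℤ (Set.range ![(⟨1, 0, 0, 0⟩ : ℍ[ℚ,-2,-13]), ⟨0, 1, 0, 0⟩, ⟨1/2, 1/2, 1/2, 0⟩, ⟨-1/2, 1/4, 0, 1/4⟩])) 1 :=
  isEichlerOrder_iff_brandt.1 isEichlerOrder_one_lattice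

end Maximal

/-! ## §4 Units: `O₁₃^×` = the `2` elements of reduced norm `1`; `w(O₁₃) = 1` -/

section Units

/-- The left order of the lattice `O₁₃` is `O₁₃`. [cite: VignerasLNM800, Ch. I §4 (ordre à gauche)] -/
theorem leftOrder_lattice : leftOrder (Submodule.span ℤ (Set.range ![(⟨1, 0, 0, 0⟩ : ℍ[ℚ,-2,-13]), ⟨0, 1, 0, 0⟩, ⟨1/2, 1/2, 1/2, 0⟩, ⟨-1/2, 1/4, 0, 1/4⟩])) = (Submodule.span ℤ (Set.range ![(⟨1, 0, 0, 0⟩ : ℍ[ℚ,-2,-13]), ⟨0, 1, 0, 0⟩, ⟨1/2, 1/2, 1/2, 0⟩, ⟨-1/2, 1/4, 0, 1/4⟩])) :=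
  leftOrder_eq_self_of_one_mem one_mem_lattice fun _ ha _ hb => mul_mem_lattice ha hb

/-- **The units of `O₁₃` are its elements of reduced norm `1`.** [cite: VignerasLNM800, Ch. I §4 Lemme 4.12] -/
theorem exists_inv_mem_iff_reducedNorm_eq_one {x : ℍ[ℚ,-2,-13]} (hx : x ∈ (Submodule.span ℤ (Set.range ![(⟨1, 0, 0, 0⟩ : ℍ[ℚ,-2,-13]), ⟨0, 1, 0, 0⟩, ⟨1/2, 1/2, 1/2, 0⟩, ⟨-1/2, 1/4, 0, 1/4⟩]))) :
    (∃ y ∈ (Submodule.span ℤ (Set.range ![(⟨1, 0, 0, 0⟩ : ℍ[ℚ,-2,-13]), ⟨0, 1, 0, 0⟩, ⟨1/2, 1/2, 1/2, 0⟩, ⟨-1/2, 1/4, 0, 1/4⟩])), x * y = 1 ∧ y * x = 1) ↔ reducedNorm ℚ ℍ[ℚ,-2,-13] x = 1 := by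
  haveI := isQuaternionAlgebra
  constructor
  · rintro ⟨y, hy, hxy, -⟩
    obtain ⟨n, hn⟩ := exists_reducedNorm_eq_natCast_of_mem hx
    obtain ⟨n', hn'⟩ := exists_reducedNorm_eq_natCast_of_mem hy
    have h : reducedNorm ℚ ℍ[ℚ,-2,-13] x * reducedNorm ℚ ℍ[ℚ,-2,-13] y = 1 := by
      rw [← reducedNorm_mul_holds ℚ ℍ[ℚ,-2,-13] x y, hxy, reducedNorm_eq]
      simp
    rw [hn, hn'] at h
    have h1 : n * n' = 1 := by exact_mod_cast h
    rw [hn]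
    exact_mod_cast Nat.eq_one_of_mul_eq_one_right h1
  · intro h
    rw [reducedNorm_eq] at h
    have hre : (x * star x).re = 1 := by rw [re_mul_star, h]
    have hre' : (star x * x).re = 1 := by
      have e : (star x * x).re = x.re ^ 2 + 2 * x.imI ^ 2 + 13 * x.imJ ^ 2 + 26 * x.imK ^ 2 := by
        simp [QuaternionAlgebra.re_mul]
        ring
      rw [e, h]
    refine ⟨star x, star_mem_lattice hx, ?_, ?_⟩
    · rw [QuaternionAlgebra.mul_star_eq_coe, hre, QuaternionAlgebra.coe_one]
    · rw [QuaternionAlgebra.star_mul_eq_coe, hre', QuaternionAlgebra.coe_one]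

/-- **For `u ∈ Bˣ`: `u ∈ O₁₃` and `u⁻¹ ∈ O₁₃` iff `u ∈ O₁₃` and `nrd u = 1`.** [cite: VignerasLNM800, Ch. I §4 Lemme 4.12] -/
theorem units_mem_and_inv_mem_iff (u : (ℍ[ℚ,-2,-13])ˣ) :
    ((u : ℍ[ℚ,-2,-13]) ∈ (Submodule.span ℤ (Set.range ![(⟨1, 0, 0, 0⟩ : ℍ[ℚ,-2,-13]), ⟨0, 1, 0, 0⟩, ⟨1/2, 1/2, 1/2, 0⟩, ⟨-1/2, 1/4, 0, 1/4⟩])) ∧ ((u⁻¹ : (ℍ[ℚ,-2,-13])ˣ) : ℍ[ℚ,-2,-13]) ∈ (Submodule.span ℤ (Set.range ![(⟨1, 0, 0, 0⟩ : ℍ[ℚ,-2,-13]), ⟨0, 1, 0, 0⟩, ⟨1/2, 1/2, 1/2, 0⟩, ⟨-1/2, 1/4, 0, 1/4⟩]))) ↔ (u : ℍ[ℚ,-2,-13]) ∈ (Submodule.span ℤ (Set.range ![(⟨1, 0, 0, 0⟩ : ℍ[ℚ,-2,-13]), ⟨0, 1, 0, 0⟩, ⟨1/2, 1/2, 1/2,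 0⟩, ⟨-1/2, 1/4, 0, 1/4⟩])) ∧ reducedNorm ℚ ℍ[ℚ,-2,-13] (u : ℍ[ℚ,-2,-13]) = 1 := by
  constructor
  · rintro ⟨hu, hu'⟩
    exact ⟨hu, (exists_inv_mem_iff_reducedNorm_eq_one hu).1 ⟨_, hu', u.mul_inv, u.inv_mul⟩⟩
  · rintro ⟨hu, h1⟩
    refine ⟨hu, ?_⟩
    obtain ⟨y, hy, hxy, -⟩ := (exists_inv_mem_iff_reducedNorm_eq_one hu).2 h1
    have : ((u⁻¹ : (ℍ[ℚ,-2,-13])ˣ) : ℍ[ℚ,-2,-13]) = y := by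
      rw [← mul_one ((u⁻¹ : (ℍ[ℚ,-2,-13])ˣ) : ℍ[ℚ,-2,-13]), ← hxy, ← mul_assoc, Units.inv_mul, one_mul]
    rw [this]
    exact hy

/-- **`uO₁₃ = O₁₃ ⟺ u ∈ O₁₃ ∧ nrd u = 1`** (`u ∈ Bˣ`): the stabiliser of the lattice `O₁₃` is its unit group.
[cite: VignerasLNM800, Ch. I §4 Lemme 4.12] -/
theorem units_smul_lattice_eq_iff (u : (ℍ[ℚ,-2,-13])ˣ) :
    u • (Submodule.span ℤ (Set.range ![(⟨1, 0, 0, 0⟩ : ℍ[ℚ,-2,-13]), ⟨0, 1, 0, 0⟩, ⟨1/2, 1/2, 1/2, 0⟩, ⟨-1/2, 1/4, 0, 1/4⟩])) = (Submodule.span ℤ (Set.range ![(⟨1, 0, 0, 0⟩ : ℍ[ℚ,-2,-13]), ⟨0, 1, 0, 0⟩, ⟨1/2, 1/2, 1/2, 0⟩, ⟨-1/2, 1/4, 0, 1/4⟩])) ↔ (u : ℍ[ℚ,-2,-13]) ∈ (Submodule.span ℤ (Set.range ![(⟨1, 0, 0, 0⟩ : ℍ[ℚ,-2,-13]), ⟨0,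 1, 0, 0⟩, ⟨1/2, 1/2, 1/2, 0⟩, ⟨-1/2, 1/4, 0, 1/4⟩])) ∧ reducedNorm ℚ ℍ[ℚ,-2,-13] (u : ℍ[ℚ,-2,-13]) = 1 := by
  rw [← units_mem_and_inv_mem_iff, ← MulAction.mem_stabilizer_iff, mem_stabilizer_iff_mem_leftOrder, leftOrder_lattice]

/-- **The elements of `O₁₃` of reduced norm `n` are the integer solutions of `a² + 2b² + 4c² + 2d² + ac − ad + 2bc + bd = n`.**
[cite: Voight2021, Exercise 17.10 (b)] -/
theorem natCard_reducedNorm_eq_natCard_form (n : ℤ) :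
    Nat.card {x : ℍ[ℚ,-2,-13] // x ∈ (Submodule.span ℤ (Set.range ![(⟨1, 0, 0, 0⟩ : ℍ[ℚ,-2,-13]), ⟨0, 1, 0, 0⟩, ⟨1/2, 1/2, 1/2, 0⟩, ⟨-1/2, 1/4, 0, 1/4⟩])) ∧ reducedNorm ℚ ℍ[ℚ,-2,-13] x = n} =
      Nat.card {v : ℤ × ℤ × ℤ × ℤ //
        v.1 ^ 2 + 2 * v.2.1 ^ 2 + 4 * v.2.2.1 ^ 2 + 2 * v.2.2.2 ^ 2 + v.1 * v.2.2.1 - v.1 * v.2.2.2 +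
          2 * v.2.1 * v.2.2.1 + v.2.1 * v.2.2.2 = n} := by
  symm
  refine Nat.card_congr (Equiv.ofBijective
    (fun v => ⟨⟨(v.1.1 : ℚ) + (v.1.2.2.1 : ℚ) / 2 - (v.1.2.2.2 : ℚ) / 2, (v.1.2.1 : ℚ) + (v.1.2.2.1 : ℚ) / 2 + (v.1.2.2.2 : ℚ) / 4,
      (v.1.2.2.1 : ℚ) / 2, (v.1.2.2.2 : ℚ) / 4⟩, mk_mem_lattice _ _ _ _, by rw [reducedNorm_mk]; exact_mod_cast v.2⟩) ⟨?_, ?_⟩)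
  · rintro ⟨⟨a, b, c, d⟩, hv⟩ ⟨⟨a', b', c', d'⟩, hv'⟩ h
    simp only [Subtype.mk.injEq, QuaternionAlgebra.mk.injEq] at h
    obtain ⟨h1, h2, h3, h4⟩ := h
    have hc : c = c' := by
      have : (c : ℚ) = c' := by linarith
      exact_mod_cast this
    have hd : d = d' := by
      have : (d : ℚ) = d' := by linarith
      exact_mod_cast this
    subst hc hd
    have ha : a = a' := by
      have : (a : ℚ) = a' := by linarith
      exact_mod_cast this
    have hb : b = b' := by
      have : (b : ℚ) = b' := by linarith
      exact_mod_cast this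
    subst ha hb
    rfl
  · rintro ⟨x, hx, hn⟩
    obtain ⟨a, b, c, d, rfl⟩ := (mem_lattice_iff x).1 hx
    rw [reducedNorm_mk] at hn
    refine ⟨⟨⟨a, b, c, d⟩, ?_⟩, rfl⟩
    have hn' : ((a ^ 2 + 2 * b ^ 2 + 4 * c ^ 2 + 2 * d ^ 2 + a * c - a * d + 2 * b * c + b * d : ℤ) : ℚ) = n := hn
    exact_mod_cast hn'

/-- **`a² + 2b² + 4c² + 2d² + ac − ad + 2bc + bd = 1` has exactly `2` integer solutions** (`±(1,0,0,0) = ±1`):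
`16·Q = 4(2a + c − d)² + 2(4b + 2c + d)² + 52c² + 26d²` confines them to a box. [cite: Voight2021, Thm. 11.5.14 and Exercise 17.10] -/
theorem natCard_form_eq_one :
    Nat.card {v : ℤ × ℤ × ℤ × ℤ //
      v.1 ^ 2 + 2 * v.2.1 ^ 2 + 4 * v.2.2.1 ^ 2 + 2 * v.2.2.2 ^ 2 + v.1 * v.2.2.1 - v.1 * v.2.2.2 +
        2 * v.2.1 * v.2.2.1 + v.2.1 * v.2.2.2 = 1} = 2 := by
  have hS : {v : ℤ × ℤ × ℤ × ℤ |
      v.1 ^ 2 + 2 * v.2.1 ^ 2 + 4 * v.2.2.1 ^ 2 + 2 * v.2.2.2 ^ 2 + v.1 * v.2.2.1 - v.1 * v.2.2.2 +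
        2 * v.2.1 * v.2.2.1 + v.2.1 * v.2.2.2 = 1} =
      ↑((Finset.Icc (-1 : ℤ) 1 ×ˢ Finset.Icc (-1 : ℤ) 1 ×ˢ Finset.Icc (-1 : ℤ) 1 ×ˢ Finset.Icc (-1 : ℤ) 1).filter
        fun v => v.1 ^ 2 + 2 * v.2.1 ^ 2 + 4 * v.2.2.1 ^ 2 + 2 * v.2.2.2 ^ 2 + v.1 * v.2.2.1 - v.1 * v.2.2.2 +
          2 * v.2.1 * v.2.2.1 + v.2.1 * v.2.2.2 = 1) := by
    ext ⟨a, b, c, d⟩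
    simp only [Set.mem_setOf_eq, Finset.coe_filter, Finset.mem_Icc, Finset.mem_product]
    constructor
    · intro h
      have h16 : 4 * (2 * a + c - d) ^ 2 + 2 * (4 * b + 2 * c + d) ^ 2 + 52 * c ^ 2 + 26 * d ^ 2 = 16 := by
        linear_combination 16 * h
      have hc2 : c ^ 2 < 1 ^ 2 := by nlinarith [sq_nonneg (2 * a + c - d), sq_nonneg (4 * b + 2 * c + d), sq_nonneg d]
      have hd2 : d ^ 2 < 1 ^ 2 := by nlinarith [sq_nonneg (2 * a + c - d), sq_nonneg (4 * b + 2 * c + d), sq_nonneg c]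
      have hP2 : (2 * a + c - d) ^ 2 < 3 ^ 2 := by nlinarith [sq_nonneg (4 * b + 2 * c + d), sq_nonneg c, sq_nonneg d]
      have hR2 : (4 * b + 2 * c + d) ^ 2 < 3 ^ 2 := by nlinarith [sq_nonneg (2 * a + c - d), sq_nonneg c, sq_nonneg d]
      have hc := abs_lt_of_sq_lt_sq' hc2 (by norm_num)
      have hd := abs_lt_of_sq_lt_sq' hd2 (by norm_num)
      have hP := abs_lt_of_sq_lt_sq' hP2 (by norm_num)
      have hR := abs_lt_of_sq_lt_sq' hR2 (by norm_num)
      refine ⟨⟨⟨?_, ?_⟩, ⟨?_, ?_⟩, ⟨?_, ?_⟩, ⟨?_, ?_⟩⟩, h⟩ <;> omega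
    · exact And.right
  have h1 : Nat.card {v : ℤ × ℤ × ℤ × ℤ //
      v.1 ^ 2 + 2 * v.2.1 ^ 2 + 4 * v.2.2.1 ^ 2 + 2 * v.2.2.2 ^ 2 + v.1 * v.2.2.1 - v.1 * v.2.2.2 +
        2 * v.2.1 * v.2.2.1 + v.2.1 * v.2.2.2 = 1} =
      Set.ncard {v : ℤ × ℤ × ℤ × ℤ |
        v.1 ^ 2 + 2 * v.2.1 ^ 2 + 4 * v.2.2.1 ^ 2 + 2 * v.2.2.2 ^ 2 + v.1 * v.2.2.1 - v.1 * v.2.2.2 +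
          2 * v.2.1 * v.2.2.1 + v.2.1 * v.2.2.2 = 1} :=
    (Nat.card_coe_set_eq _).symm
  rw [h1, hS, Set.ncard_coe_finset]
  decide

/-- **`#O₁₃^× = 2`** — the unit set `{x ∈ O₁₃ : ∃ y ∈ O₁₃, xy = yx = 1}` has `2` elements: `±1`
(Voight Thm. 11.5.14: a definite order over `ℚ` other than the three exceptional ones has cyclic unit group of order `2, 4` or `6`).
[cite: Voight2021, Thm. 11.5.14 and Exercise 17.10] -/
theorem card_units_lattice :
    Nat.card {x : ℍ[ℚ,-2,-13] // x ∈ (Submodule.span ℤ (Set.range ![(⟨1, 0, 0, 0⟩ : ℍ[ℚ,-2,-13]), ⟨0, 1, 0, 0⟩, ⟨1/2, 1/2, 1/2, 0⟩, ⟨-1/2, 1/4, 0, 1/4⟩])) ∧ ∃ y ∈ (Submodule.span ℤ (Set.range ![(⟨1, 0, 0, 0⟩ : ℍ[ℚ,-2,-13]), ⟨0, 1, 0, 0⟩, ⟨1/2, 1/2, 1/2, 0⟩, ⟨-1/2, 1/4, 0, 1/4⟩])), x * y = 1 ∧ y * x = 1} = 2 := by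
  have e : {x : ℍ[ℚ,-2,-13] // x ∈ (Submodule.span ℤ (Set.range ![(⟨1, 0, 0, 0⟩ : ℍ[ℚ,-2,-13]), ⟨0, 1, 0, 0⟩, ⟨1/2, 1/2, 1/2, 0⟩, ⟨-1/2, 1/4, 0, 1/4⟩])) ∧ ∃ y ∈ (Submodule.span ℤ (Set.range ![(⟨1, 0, 0, 0⟩ : ℍ[ℚ,-2,-13]), ⟨0, 1, 0, 0⟩, ⟨1/2, 1/2, 1/2, 0⟩, ⟨-1/2, 1/4, 0, 1/4⟩])), x * y = 1 ∧ y * x = 1} ≃ {x : ℍ[ℚ,-2,-13] // x ∈ (Submodule.span ℤ (Set.range ![(⟨1, 0, 0, 0⟩ : ℍ[ℚ,-2,-13]), ⟨0, 1, 0, 0⟩, ⟨1/2, 1/2, 1/2, 0⟩, ⟨-1/2, 1/4, 0, 1/4⟩])) ∧ reducedNorm ℚ ℍ[ℚ,-2,-13] x = (1 : ℤ)} :=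
    Equiv.subtypeEquivRight fun x => and_congr_right fun hx => by
      rw [exists_inv_mem_iff_reducedNorm_eq_one hx, Int.cast_one]
  rw [Nat.card_congr e, natCard_reducedNorm_eq_natCard_form 1, natCard_form_eq_one]

/-- **`w(O₁₃) = #O₁₃^×/2 = 1`**: the unit index of `O₁₃` (Eichler's mass at `D = 13` is `(13 − 1)/12 = 1 = 1/w`).
[cite: Voight2021, Thm. 25.1.1 and Exercise 17.10] [cite: VignerasLNM800, Ch. V §2 Cor. 2.3] -/
theorem unitIndex_lattice : unitIndex (Submodule.span ℤ (Set.range ![(⟨1, 0, 0, 0⟩ : ℍ[ℚ,-2,-13]), ⟨0, 1, 0, 0⟩, ⟨1/2, 1/2, 1/2, 0⟩, ⟨-1/2, 1/4, 0, 1/4⟩])) = 1 := by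
  rw [unitIndex, card_units_lattice]

/-- `1 ≠ −1` in `(−2,−13)_ℚ`. [folklore] -/
private theorem one_ne_neg_one : (1 : ℍ[ℚ,-2,-13]) ≠ -1 := by
  intro h
  have := congrArg QuaternionAlgebra.re h
  norm_num at this

/-- **`#Stab_{Bˣ}(O₁₃) = 2`**: the stabiliser of the lattice `O₁₃` in `Bˣ` (its unit group) has `2` elements. [cite: Voight2021, Thm. 11.5.14] -/
theorem card_stabilizer_lattice : Nat.card (MulAction.stabilizer (ℍ[ℚ,-2,-13])ˣ (Submodule.span ℤ (Set.range ![(⟨1, 0, 0, 0⟩ : ℍ[ℚ,-2,-13]), ⟨0, 1, 0, 0⟩, ⟨1/2, 1/2, 1/2, 0⟩, ⟨-1/2, 1/4, 0, 1/4⟩]))) = 2 := by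
  rw [card_stabilizer_eq_two_mul_unitIndex one_ne_neg_one, leftOrder_lattice, unitIndex_lattice]

end Units

end Literature.NumberTheory.Automorphic.MaxOrderDiscThirteen
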